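import Summits.BirchSwinnertonDyer.BirchSwinnertonDyer.Theorems.KolyvaginDepthDoorDepthTableRowKitPrint
import Summits.BirchSwinnertonDyer.BirchSwinnertonDyer.Theorems.KolyvaginDepthDoorDepthTableJLSRowsOfLeaves
import HarnessLib

/-!
# Route `KolyvaginDepthDoor` — the depth table's three PRINTED entries (Jetchev–Lauter–Stein 2009,
# Prop. 3.10 / Rem. 3.11: `389a1`, `709a1`, `718b1` at `(p, d_K, ℓ) = (3, −7, 5)`) ON PRINT-STANDARD
# INPUTS: the published computation + (γ) [Gross 3.7 (2)] + F1 [GZ86 III (3.1)] ⟹ `Ш(E/ℚ)[3] = 0`,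
# `rank = 2`, `#Sel_3(E/ℚ) = 9` — no McCallum leaf, no Kolyvagin structure theorem
# (crux `KolyvaginDepthSupply`, stmt-BirchSwinnertonDyer-21765)

Helper file (`--supports stmt-BirchSwinnertonDyer-21765 --as helper`); it closes nothing and BSD is
not proved by it.

g7's `C<label>.AtThree.jlsRow_3_neg7_5_ofLeaves` (file `…DepthTableJLSRowsOfLeaves`) read the three printed
entries modulo the computation `JetchevLauterStein2009_kolyvaginClass_five_ne_zero_at_three` and the
FIVE named McCallum / Gross leaves. After g8 the leaves are theorems (`…LeafSign`, `…LeafEigenLinePow`,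
`…LeafReciprocityPow`) or follow from the two standard published inputs (γ) =
`GrossLMS1991.prop37_2_frobeniusCongruence` and F1 = `Gross1991_heegnerPoint_sub_ratTorsion_mem_E0`
(`…LeafLocalPow`, `JET.prop44_of_frobeniusCongruence`). This file re-issues the rows over the kit
`depthRow_print_of_datum_of_intModel_certificate_gross1991E0` (file `…DepthTableRowKitPrint`):

* `C389a1.AtThree.jlsRow_3_neg7_5_print`, `C709a1.AtThree.…`, `C718b1.AtThree.…`,
  `jlsRows_sha_three_torsion_eq_zero_print` — same statements as g7's, binders
  `(h372 : (γ)) (hE0 : F1) (hJ : JLS)` in place of the five leaves + `hJ`.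

HONEST FRAMING: `p = 3` calibrates (the crux has `p ≥ 5`); CONDITIONAL on the three Literature facts
(γ), F1, JLS; per-curve; BSD is not proved by it.

References: [JetchevLauterStein2009] §3.6 Prop. 3.10, Rem. 3.11 (arXiv:0707.0032 p. 8); [GrossLMS1991]
Prop. 3.7 (2), Prop. 6.2 (1); [GrossZagier1986] III (3.1); [Kolyvagin1991MathAnn] Thm. 2.3;
[McCallumLMS1991] §§2–5; [CremonaAlgorithms1997] Table 1.
-/

set_option linter.dupNamespace false

noncomputable section

open scoped Classical

namespace Summit.BirchSwinnertonDyer.BirchSwinnertonDyer.Theorems.KolyvaginDepthDoor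

open Literature.NumberTheory.EllipticCurves Literature.NumberTheory.EllipticCurves.ModularForms
  Literature.NumberTheory.EllipticCurves.McCallum1991 WeierstrassCurve
open Summit.BirchSwinnertonDyer.BirchSwinnertonDyer.Rank2Observatory
open Summit.BirchSwinnertonDyer.BirchSwinnertonDyer.Rank1Residual

namespace C389a1.AtThree

/-- **JLS ROW `389a1` at `(p, d_K, ℓ) = (3, −7, 5)` WITHOUT Kolyvagin's structure theorem**: granted the
Literature facts (γ) (Gross 1991 Prop. 3.7 (2)) and F1 ([GZ86 III (3.1)]) — the five McCallum/Gross
leaves being theorems / (γ) / F1 after g8 — and the published computation `hJ` (JLS 2009 Prop. 3.10: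
a datum `d` of conductor `5` with `d.kolyvaginClass _ 1 ≠ 0`), for ANY imaginary quadratic `K` with
`d_K = −7`: `corank_{ℤ_3} Ш(E/ℚ)[3^∞] = 0`, `rank_ℤ E(ℚ) = 2`, `rank_ℤ E^{(−7)}(ℚ) ≤ 1`, `E(ℚ)[3] =
0`, `Ш(E/ℚ)[3] = 0`, `#Sel^(3)(E/ℚ) = 3²` — the datum of `hJ` is extended to a compatible system by
`exists_kolyvaginHeegnerSystem_extending` and run through Kolyvagin's minimal-depth descent
(`depthRow_print_of_datum_of_intModel_certificate_gross1991E0`); every side condition is a kernel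
theorem (`hasSurjectiveModNGaloisRep_pow_3`, `C389a1.not_hasCM'`, `C389a1.heegner_neg7`,
`C389a1.card_5`, `Curve389a1.two_le_mordellWeilRank`). Compare g3's `jlsRow_3_neg7_5` (mod Kolyvagin
Thm. 4, XL) and g7's `…_ofLeaves` (mod five leaves). CONDITIONAL on (γ), F1 and `hJ`; calibration
(`p = 3 < 5`), not an instance of the crux; BSD is not proved by it. [cite: JetchevLauterStein2009,
§3.6 Prop. 3.10 (arXiv:0707.0032 p. 8)] [cite: McCallumLMS1991, §§2–5] [cite: Kolyvagin1991MathAnn,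
Thm. 2.3] [cite: CremonaAlgorithms1997, Table 1 (389a1)] -/
theorem jlsRow_3_neg7_5_print
    (h372 : GrossLMS1991.prop37_2_frobeniusCongruence)
    (hE0 : Gross1991_heegnerPoint_sub_ratTorsion_mem_E0)
    (hJ : Literature.NumberTheory.EllipticCurves.JetchevLauterStein2009_kolyvaginClass_five_ne_zero_at_three)
    (K : Type) [Field K] [NumberField K] (hIQ : IsImaginaryQuadratic K)
    (hD : NumberField.discr K = -7) :
    ((⟨0, 1, 1, -2, 0⟩ : WeierstrassCurve ℤ).map (Int.castRingHom ℚ)).shaCorank 3 = 0 ∧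
      ((⟨0, 1, 1, -2, 0⟩ : WeierstrassCurve ℤ).map (Int.castRingHom ℚ)).mordellWeilRank = 2 ∧
      (((⟨0, 1, 1, -2, 0⟩ : WeierstrassCurve ℤ).map (Int.castRingHom ℚ)).quadraticTwist
        ((-7 : ℤ) : ℚ)).mordellWeilRank ≤ 1 ∧
      (∀ P : ((⟨0, 1, 1, -2, 0⟩ : WeierstrassCurve ℤ).map (Int.castRingHom ℚ)).toAffine.Point,
        3 • P = 0 → P = 0) ∧
      (∀ x ∈ ((⟨0, 1, 1, -2, 0⟩ : WeierstrassCurve ℤ).map (Int.castRingHom ℚ)).sha, 3 • x = 0 → x = 0) ∧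
      Nat.card ↥(selmerGroup ((⟨0, 1, 1, -2, 0⟩ : WeierstrassCurve ℤ).map (Int.castRingHom ℚ))
        ((3 : ℕ) : ℤ)) = 3 ^ 2 := by
  haveI := isElliptic_c389a1
  haveI := isGloballyMinimal_c389a1
  haveI : NeZero (((⟨0, 1, 1, -2, 0⟩ : WeierstrassCurve ℤ).map (Int.castRingHom ℚ)).conductorNorm ℤ) :=
    neZero_conductorNorm_of_isElliptic _
  haveI := Fact.mk (by norm_num : Nat.Prime 3)
  -- the computed bit (JLS Prop. 3.10), a datum of conductor `5`
  obtain ⟨Dt, β, ι, d, hne⟩ := hJ.1 K hIQ hD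
  -- the kernel rank certificate and non-CM, moved from `Curve389a1.E` to the `ℤ`-literal handle
  have hr : 2 ≤ ((⟨0, 1, 1, -2, 0⟩ : WeierstrassCurve ℤ).map (Int.castRingHom ℚ)).mordellWeilRank := by
    rw [IntModel.map_mk_int]
    exact Curve389a1.two_le_mordellWeilRank
  have hcm : ¬ ((⟨0, 1, 1, -2, 0⟩ : WeierstrassCurve ℤ).map (Int.castRingHom ℚ)).HasCM := by
    rw [IntModel.map_mk_int]
    exact C389a1.not_hasCM'
  exact depthRow_print_of_datum_of_intModel_certificate_gross1991E0 intModel h372 hE0 hcm hr 3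
    (by norm_num) hasSurjectiveModNGaloisRep_pow_3 K hIQ hD (by norm_num) (by norm_num)
    C389a1.heegner_neg7 5 (by norm_num) (by norm_num) (by decide +kernel) (by norm_num) (by norm_num)
    (by norm_num) (by norm_num) (n := 9) C389a1.card_5 (by norm_num) Dt β ι d hne

end C389a1.AtThree

namespace C709a1.AtThree

/-- **JLS ROW `709a1` at `(p, d_K, ℓ) = (3, −7, 5)` WITHOUT Kolyvagin's structure theorem** (JLS 2009
Rem. 3.11): granted (γ), F1 and `hJ`, for ANY imaginary quadratic `K` with `d_K = −7`: `corank_{ℤ_3}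
Ш(E/ℚ)[3^∞] = 0`, `rank_ℤ E(ℚ) = 2`, `rank_ℤ E^{(−7)}(ℚ) ≤ 1`, `E(ℚ)[3] = 0`, `Ш(E/ℚ)[3] = 0`,
`#Sel^(3)(E/ℚ) = 3²` (door of a datum; side conditions `hasSurjectiveModNGaloisRep_pow_3`,
`C709a1.not_hasCM`, `C709a1.heegner_neg7`, `C709a1.card_5`, `KernelCerts002.C709a1.two_le_rank`).
CONDITIONAL on (γ), F1 and `hJ`; calibration, not an instance of the crux; BSD is not proved by it.
[cite: JetchevLauterStein2009, §3.6 Remark 3.11 (arXiv:0707.0032 p. 8)] [cite: McCallumLMS1991,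
§§2–5] [cite: Kolyvagin1991MathAnn, Thm. 2.3] [cite: CremonaAlgorithms1997, Table 1 (709a1)] -/
theorem jlsRow_3_neg7_5_print
    (h372 : GrossLMS1991.prop37_2_frobeniusCongruence)
    (hE0 : Gross1991_heegnerPoint_sub_ratTorsion_mem_E0)
    (hJ : Literature.NumberTheory.EllipticCurves.JetchevLauterStein2009_kolyvaginClass_five_ne_zero_at_three)
    (K : Type) [Field K] [NumberField K] (hIQ : IsImaginaryQuadratic K)
    (hD : NumberField.discr K = -7) :
    ((⟨0, -1, 1, -2, 0⟩ : WeierstrassCurve ℤ).map (Int.castRingHom ℚ)).shaCorank 3 = 0 ∧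
      ((⟨0, -1, 1, -2, 0⟩ : WeierstrassCurve ℤ).map (Int.castRingHom ℚ)).mordellWeilRank = 2 ∧
      (((⟨0, -1, 1, -2, 0⟩ : WeierstrassCurve ℤ).map (Int.castRingHom ℚ)).quadraticTwist
        ((-7 : ℤ) : ℚ)).mordellWeilRank ≤ 1 ∧
      (∀ P : ((⟨0, -1, 1, -2, 0⟩ : WeierstrassCurve ℤ).map (Int.castRingHom ℚ)).toAffine.Point,
        3 • P = 0 → P = 0) ∧
      (∀ x ∈ ((⟨0, -1, 1, -2, 0⟩ : WeierstrassCurve ℤ).map (Int.castRingHom ℚ)).sha, 3 • x = 0 → x = 0) ∧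
      Nat.card ↥(selmerGroup ((⟨0, -1, 1, -2, 0⟩ : WeierstrassCurve ℤ).map (Int.castRingHom ℚ))
        ((3 : ℕ) : ℤ)) = 3 ^ 2 := by
  haveI := isElliptic_c709a1
  haveI := isGloballyMinimal_c709a1
  haveI : NeZero (((⟨0, -1, 1, -2, 0⟩ : WeierstrassCurve ℤ).map (Int.castRingHom ℚ)).conductorNorm ℤ) :=
    neZero_conductorNorm_of_isElliptic _
  haveI := Fact.mk (by norm_num : Nat.Prime 3)
  obtain ⟨Dt, β, ι, d, hne⟩ := hJ.2.1 K hIQ hD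
  exact depthRow_print_of_datum_of_intModel_certificate_gross1991E0 C709a1.intModel h372 hE0
    C709a1.not_hasCM KernelCerts002.C709a1.two_le_rank 3 (by norm_num) hasSurjectiveModNGaloisRep_pow_3
    K hIQ hD (by norm_num) (by norm_num) C709a1.heegner_neg7 5 (by norm_num) (by norm_num)
    (by decide +kernel) (by norm_num) (by norm_num) (by norm_num) (by norm_num) (n := 9) C709a1.card_5
    (by norm_num) Dt β ι d hne

end C709a1.AtThree

namespace C718b1.AtThree

/-- **JLS ROW `718b1` at `(p, d_K, ℓ) = (3, −7, 5)` WITHOUT Kolyvagin's structure theorem** (JLS 2009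
Rem. 3.11): granted (γ), F1 and `hJ`, for ANY imaginary quadratic `K` with `d_K = −7`: `corank_{ℤ_3}
Ш(E/ℚ)[3^∞] = 0`, `rank_ℤ E(ℚ) = 2`, `rank_ℤ E^{(−7)}(ℚ) ≤ 1`, `E(ℚ)[3] = 0`, `Ш(E/ℚ)[3] = 0`,
`#Sel^(3)(E/ℚ) = 3²` (door of a datum; side conditions `hasSurjectiveModNGaloisRep_pow_3`,
`C718b1.not_hasCM`, `C718b1.heegner_neg7`, `C718b1.card_5`, `KernelCerts002.C718b1.two_le_rank`).
CONDITIONAL on (γ), F1 and `hJ`; calibration, not an instance of the crux; BSD is not proved by it.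
[cite: JetchevLauterStein2009, §3.6 Remark 3.11 (arXiv:0707.0032 p. 8)] [cite: McCallumLMS1991,
§§2–5] [cite: Kolyvagin1991MathAnn, Thm. 2.3] [cite: CremonaAlgorithms1997, Table 1 (718b1)] -/
theorem jlsRow_3_neg7_5_print
    (h372 : GrossLMS1991.prop37_2_frobeniusCongruence)
    (hE0 : Gross1991_heegnerPoint_sub_ratTorsion_mem_E0)
    (hJ : Literature.NumberTheory.EllipticCurves.JetchevLauterStein2009_kolyvaginClass_five_ne_zero_at_three)
    (K : Type) [Field K] [NumberField K] (hIQ : IsImaginaryQuadratic K)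
    (hD : NumberField.discr K = -7) :
    ((⟨1, 0, 1, -5, 0⟩ : WeierstrassCurve ℤ).map (Int.castRingHom ℚ)).shaCorank 3 = 0 ∧
      ((⟨1, 0, 1, -5, 0⟩ : WeierstrassCurve ℤ).map (Int.castRingHom ℚ)).mordellWeilRank = 2 ∧
      (((⟨1, 0, 1, -5, 0⟩ : WeierstrassCurve ℤ).map (Int.castRingHom ℚ)).quadraticTwist
        ((-7 : ℤ) : ℚ)).mordellWeilRank ≤ 1 ∧
      (∀ P : ((⟨1, 0, 1, -5, 0⟩ : WeierstrassCurve ℤ).map (Int.castRingHom ℚ)).toAffine.Point,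
        3 • P = 0 → P = 0) ∧
      (∀ x ∈ ((⟨1, 0, 1, -5, 0⟩ : WeierstrassCurve ℤ).map (Int.castRingHom ℚ)).sha, 3 • x = 0 → x = 0) ∧
      Nat.card ↥(selmerGroup ((⟨1, 0, 1, -5, 0⟩ : WeierstrassCurve ℤ).map (Int.castRingHom ℚ))
        ((3 : ℕ) : ℤ)) = 3 ^ 2 := by
  haveI := isElliptic_c718b1
  haveI := isGloballyMinimal_c718b1
  haveI : NeZero (((⟨1, 0, 1, -5, 0⟩ : WeierstrassCurve ℤ).map (Int.castRingHom ℚ)).conductorNorm ℤ) :=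
    neZero_conductorNorm_of_isElliptic _
  haveI := Fact.mk (by norm_num : Nat.Prime 3)
  obtain ⟨Dt, β, ι, d, hne⟩ := hJ.2.2 K hIQ hD
  exact depthRow_print_of_datum_of_intModel_certificate_gross1991E0 C718b1.intModel h372 hE0
    C718b1.not_hasCM KernelCerts002.C718b1.two_le_rank 3 (by norm_num) hasSurjectiveModNGaloisRep_pow_3
    K hIQ hD (by norm_num) (by norm_num) C718b1.heegner_neg7 5 (by norm_num) (by norm_num)
    (by decide +kernel) (by norm_num) (by norm_num) (by norm_num) (by norm_num) (n := 9) C718b1.card_5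
    (by norm_num) Dt β ι d hne

end C718b1.AtThree

/-- **The three printed depth-table entries without Kolyvagin's structure theorem** (JLS 2009 Prop. 3.10
/ Rem. 3.11 at `(3, −7, 5)`): modulo the Literature facts (γ), F1 and the published computation,
`Ш(E/ℚ)[3] = 0` (every class killed by `3` is trivial) and `rank_ℤ E(ℚ) = 2` for `E = 389a1`,
`709a1`, `718b1`, for ANY imaginary quadratic `K` of discriminant `−7` (the printed `ℚ(√−7)`).
Calibration of the instrument (`p = 3 < 5`); BSD is not proved by it. [cite: JetchevLauterStein2009,
§3.6 Prop. 3.10 and Remark 3.11 (arXiv:0707.0032 p. 8)] [cite: McCallumLMS1991, §§2–5] -/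
theorem jlsRows_sha_three_torsion_eq_zero_print
    (h372 : GrossLMS1991.prop37_2_frobeniusCongruence)
    (hE0 : Gross1991_heegnerPoint_sub_ratTorsion_mem_E0)
    (hJ : Literature.NumberTheory.EllipticCurves.JetchevLauterStein2009_kolyvaginClass_five_ne_zero_at_three)
    (K : Type) [Field K] [NumberField K] (hIQ : IsImaginaryQuadratic K)
    (hD : NumberField.discr K = -7) :
    ((∀ x ∈ ((⟨0, 1, 1, -2, 0⟩ : WeierstrassCurve ℤ).map (Int.castRingHom ℚ)).sha, 3 • x = 0 → x = 0) ∧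
      ((⟨0, 1, 1, -2, 0⟩ : WeierstrassCurve ℤ).map (Int.castRingHom ℚ)).mordellWeilRank = 2) ∧
    ((∀ x ∈ ((⟨0, -1, 1, -2, 0⟩ : WeierstrassCurve ℤ).map (Int.castRingHom ℚ)).sha, 3 • x = 0 → x = 0) ∧
      ((⟨0, -1, 1, -2, 0⟩ : WeierstrassCurve ℤ).map (Int.castRingHom ℚ)).mordellWeilRank = 2) ∧
    ((∀ x ∈ ((⟨1, 0, 1, -5, 0⟩ : WeierstrassCurve ℤ).map (Int.castRingHom ℚ)).sha, 3 • x = 0 → x = 0) ∧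
      ((⟨1, 0, 1, -5, 0⟩ : WeierstrassCurve ℤ).map (Int.castRingHom ℚ)).mordellWeilRank = 2) := by
  obtain ⟨-, h1r, -, -, h1s, -⟩ := C389a1.AtThree.jlsRow_3_neg7_5_print h372 hE0 hJ K hIQ hD
  obtain ⟨-, h2r, -, -, h2s, -⟩ := C709a1.AtThree.jlsRow_3_neg7_5_print h372 hE0 hJ K hIQ hD
  obtain ⟨-, h3r, -, -, h3s, -⟩ := C718b1.AtThree.jlsRow_3_neg7_5_print h372 hE0 hJ K hIQ hD
  exact ⟨⟨h1s, h1r⟩, ⟨h2s, h2r⟩, ⟨h3s, h3r⟩⟩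

end Summit.BirchSwinnertonDyer.BirchSwinnertonDyer.Theorems.KolyvaginDepthDoor

end
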